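import Mathlib
import Summits.MatrixMultiplication.MatrixMultiplication.Theorems.SoloBlindFlatCheck
import Summits.MatrixMultiplication.MatrixMultiplication.Theorems.SoloBlindFlatMultiplicity
import Summits.MatrixMultiplication.MatrixMultiplication.Theorems.SoloBlindFamChecker

/-!
# Solo-blind (K₃) programme — soundness of the pattern DFS of the K♭ / E♭ checker

Pattern-model semantics of `soloBlindFlatFamCheck` (file `SoloBlindFlatCheck`).  For a family `F` with
pattern list `ps = soloBlindPats T m F`, a set `J` of pattern indices SEES member `k` through
`(ps j).testBit k`; its pattern mass at multiplicity one is
`soloBlindPatMass (range |F|) sz J sees 1 = ∑_k 2^{-(|M_k| + #{j ∈ J : j sees k})}`.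
`J` is VALID when every killer mask of the instance meets `J`.

MAIN THEOREM `soloBlind_flatFamCheck_sound`: if the check accepts, then for every nonempty valid `J`
(indices below `ps.length`)
* (V0) `patMass(J) - 2^{-(eoff + |J|)} ≤ R` and
* (V1) `patRest_j(J) ≤ R` for every `j ∈ J`,
with `R = (one - dterm) / 2^S` (`= 1 - 2^{-d}` in mode K, `1/2 - 2^{-(d+1)}` in mode E).  The proof is an
induction over the DFS `soloBlindFlatKids` with the prune justified by antitonicity of the pattern mass.
-/

namespace Summit.MatrixMultiplication.MatrixMultiplication.Theorems

open Finset

/-! ## Semantics of the scaled arithmetic -/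

/-- The `sees` relation of a pattern list: pattern index `j` sees member index `k`. -/
def soloBlindSeesL (ps : List ℕ) (j k : ℕ) : Bool := (ps.getD j 0).testBit k

/-- Member sizes of an instance as a function. -/
def soloBlindSzL (szs : List ℕ) (k : ℕ) : ℕ := szs.getD k 0

/-- The power table reproduces `2^(S-e)`. -/
theorem soloBlindNGet_powTab {S e : ℕ} (he : e ≤ S) : soloBlindNGet (soloBlindPowTab S) e = 2 ^ (S - e) := by
  unfold soloBlindNGet soloBlindPowTab
  rw [dif_pos (by simp; omega), Array.getElem_ofFn]

/-- With the power table, `Up` is the truncated power `soloBlindPow2T`. -/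
theorem soloBlindUp_eq (S e : ℕ) : soloBlindUp (soloBlindPowTab S) S e = soloBlindPow2T S e := by
  unfold soloBlindUp soloBlindPow2T
  split_ifs with he
  · exact soloBlindNGet_powTab he
  · rfl

/-- `Dn` under-approximates the scaled dyadic weight. -/
theorem soloBlindDn_le (S e : ℕ) : (soloBlindDn S e : ℚ) ≤ (1 / 2 : ℚ) ^ e * 2 ^ S := by
  unfold soloBlindDn
  split_ifs with he
  · push_cast
    have h2 : (2 : ℚ) ^ S = 2 ^ e * 2 ^ (S - e) := by rw [← pow_add, Nat.add_sub_cancel' he]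
    rw [h2, ← mul_assoc, ← mul_pow]
    norm_num
  · push_cast
    positivity

/-- SCALED MASS DOMINATES: if `cnt` lists the exponents `#{j ∈ J : j sees k}`, then
`patMass(J) · 2^S ≤ Ksc`. -/
theorem soloBlind_patMass_le_ksc (S : ℕ) (szs cnt : List ℕ) (ps : List ℕ) (J : Finset ℕ)
    (hcnt : ∀ k < szs.length, cnt.getD k 0 = (J.filter fun j => soloBlindSeesL ps j k).card) :
    soloBlindPatMass (Finset.range szs.length) (soloBlindSzL szs) J (soloBlindSeesL ps) (fun _ => 1)
        * 2 ^ S ≤ (soloBlindKsc (soloBlindPowTab S) S szs cnt : ℚ) := by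
  unfold soloBlindPatMass soloBlindKsc
  push_cast
  rw [Finset.sum_mul]
  apply Finset.sum_le_sum
  intro k hk
  rw [Finset.mem_range] at hk
  rw [soloBlindUp_eq, hcnt k hk]
  have hexp : soloBlindPatExp J (soloBlindSeesL ps) (fun _ => 1) k
      = (J.filter fun j => soloBlindSeesL ps j k).card := by
    unfold soloBlindPatExp
    rw [Finset.card_eq_sum_ones]
  rw [hexp]
  exact soloBlind_halfPow_mul_le S _

/-- SCALED REST DOMINATES: `patRest_j(J) · 2^S ≤ RestSc (ps j)`. -/
theorem soloBlind_patRest_le_restSc (S : ℕ) (szs cnt : List ℕ) (ps : List ℕ) (J : Finset ℕ) (j : ℕ)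
    (hcnt : ∀ k < szs.length, cnt.getD k 0 = (J.filter fun j => soloBlindSeesL ps j k).card) :
    soloBlindPatRest (Finset.range szs.length) (soloBlindSzL szs) J (soloBlindSeesL ps) (fun _ => 1) j
        * 2 ^ S ≤ (soloBlindRestSc (soloBlindPowTab S) S szs cnt (ps.getD j 0) : ℚ) := by
  unfold soloBlindPatRest soloBlindRestSc
  push_cast
  rw [Finset.sum_mul]
  have hfilter : (Finset.range szs.length).filter (fun k => soloBlindSeesL ps j k = false)
      = (Finset.range szs.length).filter (fun k => !(ps.getD j 0).testBit k) := by
    apply Finset.filter_congr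
    intro k _
    simp [soloBlindSeesL]
  rw [hfilter]
  apply Finset.sum_le_sum
  intro k hk
  rw [Finset.mem_filter, Finset.mem_range] at hk
  rw [soloBlindUp_eq, hcnt k hk.1]
  have hexp : soloBlindPatExp J (soloBlindSeesL ps) (fun _ => 1) k
      = (J.filter fun j => soloBlindSeesL ps j k).card := by
    unfold soloBlindPatExp
    rw [Finset.card_eq_sum_ones]
  rw [hexp]
  exact soloBlind_halfPow_mul_le S _

/-- The pattern mass is antitone in the pattern set. -/
theorem soloBlind_patMass_anti {α β : Type*} [DecidableEq β] (P : Finset α) (sz : α → ℕ)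
    (sees : β → α → Bool) {J J' : Finset β} (h : J ⊆ J') :
    soloBlindPatMass P sz J' sees (fun _ => 1) ≤ soloBlindPatMass P sz J sees (fun _ => 1) := by
  unfold soloBlindPatMass
  apply Finset.sum_le_sum
  intro C _
  apply pow_le_pow_of_le_one (by norm_num) (by norm_num)
  apply Nat.add_le_add_left
  unfold soloBlindPatExp
  apply Finset.sum_le_sum_of_subset_of_nonneg (Finset.filter_subset_filter _ h)
  intros; exact Nat.zero_le _

/-- The rest is at most the mass. -/
theorem soloBlind_patRest_le_patMass {α β : Type*} [DecidableEq β] (P : Finset α) (sz : α → ℕ)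
    (sees : β → α → Bool) (J : Finset β) (n : β → ℕ) (π : β) :
    soloBlindPatRest P sz J sees n π ≤ soloBlindPatMass P sz J sees n := by
  unfold soloBlindPatRest soloBlindPatMass
  apply Finset.sum_le_sum_of_subset_of_nonneg (Finset.filter_subset _ _)
  intros; positivity

/-! ## Semantics of masks, counts and validity -/

/-- Semantic validity: every killer mask has a bit inside `J`. -/
def soloBlindValidSem (kms : List ℕ) (J : Finset ℕ) : Prop := ∀ km ∈ kms, ∃ j ∈ J, km.testBit j = true

/-- A nonzero `land` has a common bit. -/
theorem soloBlind_land_ne_zero_of_bit {a b : ℕ} {i : ℕ} (ha : a.testBit i = true) (hb : b.testBit i = true) :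
    a &&& b ≠ 0 := by
  intro h
  have := Nat.testBit_land a b i
  rw [h, Nat.zero_testBit, ha, hb] at this
  simp at this

/-- Semantic validity makes the mask test succeed. -/
theorem soloBlind_validMask_of_sem {kms : List ℕ} {J : Finset ℕ} {pm : ℕ}
    (hpm : ∀ i, pm.testBit i = true ↔ i ∈ J) (hv : soloBlindValidSem kms J) :
    soloBlindValidMask kms pm = true := by
  unfold soloBlindValidMask
  rw [List.all_eq_true]
  intro km hkm
  obtain ⟨j, hj, hbit⟩ := hv km hkm
  simpa using soloBlind_land_ne_zero_of_bit hbit ((hpm j).2 hj)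

/-- Bits of `pm ||| 2^j`. -/
theorem soloBlind_testBit_or_pow {pm j : ℕ} {J : Finset ℕ} (hpm : ∀ i, pm.testBit i = true ↔ i ∈ J) (i : ℕ) :
    (pm ||| 2 ^ j).testBit i = true ↔ i ∈ insert j J := by
  rw [Nat.testBit_or, Bool.or_eq_true, hpm i, Nat.testBit_two_pow, Finset.mem_insert, decide_eq_true_eq]
  tauto

/-- Entries of the bumped count list. -/
theorem soloBlind_getD_bump (cnt : List ℕ) (p : ℕ) {k : ℕ} (hk : k < cnt.length) :
    (soloBlindBump cnt p).getD k 0 = cnt.getD k 0 + if p.testBit k then 1 else 0 := by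
  unfold soloBlindBump
  rw [List.getD_eq_getElem _ _ (by simpa using hk)]
  simp [hk]

/-- Length of the bumped count list. -/
theorem soloBlind_length_bump (cnt : List ℕ) (p : ℕ) : (soloBlindBump cnt p).length = cnt.length := by
  simp [soloBlindBump]

/-- The count invariant survives a bump by a fresh pattern index. -/
theorem soloBlind_bump_invariant {szs cnt : List ℕ} {ps : List ℕ} {J : Finset ℕ} {j : ℕ} (hjJ : j ∉ J)
    (hlen : cnt.length = szs.length)
    (hcnt : ∀ k < szs.length, cnt.getD k 0 = (J.filter fun j => soloBlindSeesL ps j k).card) :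
    ∀ k < szs.length, (soloBlindBump cnt (ps.getD j 0)).getD k 0
      = ((insert j J).filter fun j' => soloBlindSeesL ps j' k).card := by
  intro k hk
  rw [soloBlind_getD_bump cnt _ (by omega), hcnt k hk, Finset.filter_insert]
  unfold soloBlindSeesL
  by_cases hb : (ps.getD j 0).testBit k
  · rw [if_pos hb, if_pos hb, Finset.card_insert_of_notMem (fun h => hjJ (Finset.mem_filter.1 h).1)]
  · rw [if_neg hb, if_neg hb, add_zero]

/-! ## The vertex conditions, semantically -/

/-- The semantic vertex conditions of the pattern set `J` for the instance data. -/
def soloBlindVtx (S : ℕ) (szs ps : List ℕ) (one dterm eoff : ℕ) (J : Finset ℕ) : Prop :=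
  soloBlindPatMass (Finset.range szs.length) (soloBlindSzL szs) J (soloBlindSeesL ps) (fun _ => 1)
      - (1 / 2 : ℚ) ^ (eoff + J.card) ≤ ((one : ℚ) - dterm) / 2 ^ S ∧
    ∀ j ∈ J, soloBlindPatRest (Finset.range szs.length) (soloBlindSzL szs) J (soloBlindSeesL ps)
      (fun _ => 1) j ≤ ((one : ℚ) - dterm) / 2 ^ S

/-- PRUNE: if the scaled mass of `J₁` is already below `one - dterm`, every superset satisfies the
vertex conditions. -/
theorem soloBlind_vtx_of_prune {S : ℕ} {szs cnt ps : List ℕ} {one dterm eoff : ℕ} {J₁ J : Finset ℕ}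
    (hcnt : ∀ k < szs.length, cnt.getD k 0 = (J₁.filter fun j => soloBlindSeesL ps j k).card)
    (hpr : soloBlindKsc (soloBlindPowTab S) S szs cnt + dterm ≤ one) (hsub : J₁ ⊆ J) :
    soloBlindVtx S szs ps one dterm eoff J := by
  have h2S : (0 : ℚ) < 2 ^ S := by positivity
  have hm := soloBlind_patMass_le_ksc S szs cnt ps J₁ hcnt
  have hanti := soloBlind_patMass_anti (Finset.range szs.length) (soloBlindSzL szs) (soloBlindSeesL ps) hsub
  have hpr' : (soloBlindKsc (soloBlindPowTab S) S szs cnt : ℚ) + dterm ≤ one := by exact_mod_cast hpr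
  have key : soloBlindPatMass (Finset.range szs.length) (soloBlindSzL szs) J (soloBlindSeesL ps) (fun _ => 1)
      ≤ ((one : ℚ) - dterm) / 2 ^ S := by
    rw [le_div_iff₀ h2S]
    have := mul_le_mul_of_nonneg_right hanti (le_of_lt h2S)
    linarith
  refine ⟨?_, fun j _ => (soloBlind_patRest_le_patMass _ _ _ J _ j).trans key⟩
  have : (0 : ℚ) ≤ (1 / 2 : ℚ) ^ (eoff + J.card) := by positivity
  linarith

/-- HERE: the node test at a valid `J` yields the vertex conditions of `J`. -/
theorem soloBlind_vtx_of_here {S : ℕ} {szs cnt ps kms : List ℕ} {one dterm eoff pm : ℕ}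
    {chosen : List ℕ} {J : Finset ℕ}
    (hpm : ∀ i, pm.testBit i = true ↔ i ∈ J)
    (hcnt : ∀ k < szs.length, cnt.getD k 0 = (J.filter fun j => soloBlindSeesL ps j k).card)
    (hch : ∀ j ∈ J, ps.getD j 0 ∈ chosen)
    (hv : soloBlindValidSem kms J)
    (hhere : soloBlindHere ⟨S, soloBlindPowTab S, szs, kms, one, dterm, eoff⟩ pm J.card cnt chosen = true) :
    soloBlindVtx S szs ps one dterm eoff J := by
  unfold soloBlindHere at hhere
  rw [soloBlind_validMask_of_sem hpm hv] at hhere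
  simp only [Bool.not_true, Bool.false_or, Bool.and_eq_true, decide_eq_true_eq, List.all_eq_true] at hhere
  obtain ⟨h0, h1⟩ := hhere
  have h2S : (0 : ℚ) < 2 ^ S := by positivity
  have hm := soloBlind_patMass_le_ksc S szs cnt ps J hcnt
  constructor
  · have h0' : (soloBlindKsc (soloBlindPowTab S) S szs cnt : ℚ) + dterm ≤ one + soloBlindDn S (eoff + J.card) := by
      exact_mod_cast h0
    have hdn := soloBlindDn_le S (eoff + J.card)
    rw [le_div_iff₀ h2S, sub_mul]
    linarith
  · intro j hj
    have h1j := h1 _ (hch j hj)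
    have h1' : (soloBlindRestSc (soloBlindPowTab S) S szs cnt (ps.getD j 0) : ℚ) + dterm ≤ one := by
      exact_mod_cast h1j
    have hr := soloBlind_patRest_le_restSc S szs cnt ps J j hcnt
    rw [le_div_iff₀ h2S]
    linarith

/-! ## The DFS induction -/

/-- SOUNDNESS OF THE DFS below a node `J₀`: every valid proper superset `J` of `J₀` inside `J₀ ∪ L`
satisfies the vertex conditions. -/
theorem soloBlindFlatKids_sound {S : ℕ} {szs ps kms : List ℕ} {one dterm eoff : ℕ} :
    ∀ (L : List ℕ) (J₀ : Finset ℕ) (pm : ℕ) (cnt chosen : List ℕ),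
      L.Nodup → (∀ j ∈ L, j ∉ J₀) →
      (∀ i, pm.testBit i = true ↔ i ∈ J₀) →
      cnt.length = szs.length →
      (∀ k < szs.length, cnt.getD k 0 = (J₀.filter fun j => soloBlindSeesL ps j k).card) →
      (∀ j ∈ J₀, ps.getD j 0 ∈ chosen) →
      soloBlindFlatKids ⟨S, soloBlindPowTab S, szs, kms, one, dterm, eoff⟩
        (L.map fun j => (j, ps.getD j 0)) pm J₀.card cnt chosen = true →
      ∀ J : Finset ℕ, J₀ ⊂ J → J ⊆ J₀ ∪ L.toFinset → soloBlindValidSem kms J →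
        soloBlindVtx S szs ps one dterm eoff J := by
  intro L
  induction L with
  | nil =>
    intro J₀ pm cnt chosen _ _ _ _ _ _ _ J hlt hsub _
    exfalso
    simp only [List.toFinset_nil, Finset.union_empty] at hsub
    exact hlt.2 hsub
  | cons j L ih =>
    intro J₀ pm cnt chosen hnd hdisj hpm hlen hcnt hch hkids J hlt hsub hv
    rw [List.nodup_cons] at hnd
    obtain ⟨hjL, hndL⟩ := hnd
    have hjJ₀ : j ∉ J₀ := hdisj j (List.mem_cons_self)
    simp only [List.map_cons, soloBlindFlatKids, Bool.and_eq_true, Bool.or_eq_true,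
      decide_eq_true_eq] at hkids
    obtain ⟨⟨hhere, hdeep⟩, hskip⟩ := hkids
    by_cases hjJ : j ∈ J
    · -- `J ⊇ J₁ = insert j J₀`
      set J₁ := insert j J₀ with hJ₁
      have hJ₁J : J₁ ⊆ J := Finset.insert_subset hjJ hlt.1
      have hcard : J₁.card = J₀.card + 1 := Finset.card_insert_of_notMem hjJ₀
      have hpm₁ : ∀ i, (pm ||| 2 ^ j).testBit i = true ↔ i ∈ J₁ := soloBlind_testBit_or_pow hpm
      have hcnt₁ := soloBlind_bump_invariant (ps := ps) hjJ₀ hlen hcnt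
      have hlen₁ : (soloBlindBump cnt (ps.getD j 0)).length = szs.length := by
        rw [soloBlind_length_bump, hlen]
      have hch₁ : ∀ j' ∈ J₁, ps.getD j' 0 ∈ ps.getD j 0 :: chosen := by
        intro j' hj'
        rcases Finset.mem_insert.1 hj' with rfl | hj'
        · exact List.mem_cons_self
        · exact List.mem_cons_of_mem _ (hch j' hj')
      by_cases heq : J = J₁
      · subst heq
        rw [← hcard] at hhere
        exact soloBlind_vtx_of_here hpm₁ hcnt₁ hch₁ hv hhere
      · have hlt₁ : J₁ ⊂ J := lt_of_le_of_ne hJ₁J (Ne.symm heq)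
        rcases hdeep with hpr | hkids₁
        · exact soloBlind_vtx_of_prune hcnt₁ hpr hJ₁J
        · rw [← hcard] at hkids₁
          refine ih J₁ _ _ _ hndL ?_ hpm₁ hlen₁ hcnt₁ hch₁ hkids₁ J hlt₁ ?_ hv
          · intro j' hj' hmem
            rcases Finset.mem_insert.1 hmem with rfl | hmem
            · exact hjL hj'
            · exact hdisj j' (List.mem_cons_of_mem _ hj') hmem
          · intro i hi
            have := hsub hi
            simp only [Finset.mem_union, List.toFinset_cons, Finset.mem_insert, List.mem_toFinset] at this
            simp only [hJ₁, Finset.mem_union, Finset.mem_insert, List.mem_toFinset]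
            tauto
    · -- `j ∉ J`: the skip branch
      refine ih J₀ pm cnt chosen hndL (fun j' hj' => hdisj j' (List.mem_cons_of_mem _ hj')) hpm hlen
        hcnt hch hskip J hlt ?_ hv
      intro i hi
      have := hsub hi
      simp only [Finset.mem_union, List.toFinset_cons, Finset.mem_insert, List.mem_toFinset] at this
      simp only [Finset.mem_union, List.mem_toFinset]
      rcases this with h | rfl | h
      · exact Or.inl h
      · exact absurd hi hjJ
      · exact Or.inr h


/-! ## The root -/

/-- SOUNDNESS OF THE FAMILY CHECK (pattern-model level): every nonempty valid set of pattern indices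
satisfies the vertex conditions (V0), (V1) of the instance. -/
theorem soloBlind_flatFamCheck_sound (T : SoloBlindFlatTabs) (m S : ℕ) (F : List ℕ) (modeE : Bool)
    (hcheck : soloBlindFlatFamCheck T m S F modeE = true) (J : Finset ℕ) (hJ : J.Nonempty)
    (hJlt : ∀ j ∈ J, j < (soloBlindPats T m F).length)
    (hv : soloBlindValidSem (soloBlindFlatInstOf T m S F modeE).kms J) :
    soloBlindVtx S ((soloBlindFlatInstOf T m S F modeE).szs) (soloBlindPats T m F)
      (soloBlindFlatInstOf T m S F modeE).one (soloBlindFlatInstOf T m S F modeE).dterm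
      (soloBlindFlatInstOf T m S F modeE).eoff J := by
  unfold soloBlindFlatFamCheck at hcheck
  rw [Bool.or_eq_true, decide_eq_true_eq] at hcheck
  set I := soloBlindFlatInstOf T m S F modeE with hI
  set ps := soloBlindPats T m F with hps
  have hIdef : I = ⟨S, soloBlindPowTab S, I.szs, I.kms, I.one, I.dterm, I.eoff⟩ := by
    rw [hI]; rfl
  have hszs : I.szs = F.map fun M => (soloBlindDecSet m M).card := by rw [hI]; rfl
  set cnt0 : List ℕ := F.map fun _ => 0 with hcnt0
  have hlen : cnt0.length = I.szs.length := by rw [hszs]; simp [hcnt0]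
  have hcnt : ∀ k < I.szs.length, cnt0.getD k 0
      = ((∅ : Finset ℕ).filter fun j => soloBlindSeesL ps j k).card := by
    intro k hk
    rw [Finset.filter_empty, Finset.card_empty, hcnt0, List.getD_eq_getElem _ _ (by rw [hszs] at hk; simpa using hk)]
    simp
  have hsub : J ⊆ ∅ ∪ (List.range ps.length).toFinset := by
    intro j hj
    simp only [Finset.empty_union, List.mem_toFinset, List.mem_range]
    exact hJlt j hj
  have hlt : (∅ : Finset ℕ) ⊂ J := by
    rw [Finset.ssubset_iff_subset_ne]
    exact ⟨Finset.empty_subset _, fun h => hJ.ne_empty h.symm⟩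
  rcases hcheck with hpr | hkids
  · have hpr' : soloBlindKsc (soloBlindPowTab S) S I.szs cnt0 + I.dterm ≤ I.one := by
      have : I.P = soloBlindPowTab S := by rw [hI]; rfl
      rw [← this]; exact hpr
    exact soloBlind_vtx_of_prune hcnt hpr' (Finset.empty_subset J)
  · rw [hIdef] at hkids
    have hpm : ∀ i, (0 : ℕ).testBit i = true ↔ i ∈ (∅ : Finset ℕ) := by simp
    have hkids' : soloBlindFlatKids ⟨S, soloBlindPowTab S, I.szs, I.kms, I.one, I.dterm, I.eoff⟩
        ((List.range ps.length).map fun j => (j, ps.getD j 0)) 0 (∅ : Finset ℕ).card cnt0 [] = true := by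
      rw [Finset.card_empty]
      exact hkids
    exact soloBlindFlatKids_sound (List.range ps.length) ∅ 0 cnt0 [] List.nodup_range
      (fun _ _ h => Finset.notMem_empty _ h) hpm hlen hcnt (fun _ h => absurd h (Finset.notMem_empty _))
      hkids' J hlt hsub hv

end Summit.MatrixMultiplication.MatrixMultiplication.Theorems
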